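import Summits.QuantumFields.BalabanUV.T4Continuum.Support.MinimalActionRate
import Summits.QuantumFields.BalabanUV.T4Continuum.Support.AveragingDeficitTransport
import Literature.MathematicalPhysics.QuantumFieldTheory.Balaban1983to89.B7Prop1Local
import HarnessLib

/-!
# Balaban UV nodes, N16 width lane (N07 → N16 in-edge), file 22a: THE SHEET DATUM AND THE COVARIANT CHAIN (kinematics for file 22b)

Explicit-unit helper of lineage `pub-ymgap-dag-n16-w1` (generation 8), cell `pub-ymgap`, keyed to K3⁸ `stmt-QuantumFields-27366`
(`SpineGivenEndpointR13SepCoPHV`, skeleton v6 b4e55110ab73e679).  `--kind proof --supports stmt-QuantumFields-27366 --as helper`.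
COUNT-NEUTRAL: no statement item is closed, no stub of the v6 skeleton (`stub_rates13HV`, `stub_expansion13HV`) is named or
discharged, node N07 and node N16 are NOT discharged here.  File 22b (`…N16SupKeyLetterFloor`) uses these objects to put a FLOOR under the
gradient letter `c` of the lineage's sup key supKey(C, c) (files 17–21; node N07's debt [Balaban1985Variational] Thm 1 (8)+(10) at the
(42)-objects, uniformly in `k`).

## What is proved (sorry-free, classical axioms only, THEOREMS ONLY — 0 `def`)

* §1 `exists_central_unitary_norm_sub_one_eq` — a central unitary unit `w = ζ(ε)·1` of `M_n(ℂ)` at operator-norm distance EXACTLY `ε` from `1`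
  (`ζ(ε) = (1 − ε²∕2) + iε√(1 − ε²∕4)`, `0 ≤ ε ≤ 2`; no trigonometry).
* §2 THE SHEET EQUATIONS `V(x, κ) = 1 (κ ≠ ν₀)`, `V(x, ν₀) = w` if `N ∣ x_{μ₀}` else `1` (hypotheses `h1`, `h2`; solved by `exists_sheetEqs`): a
  solution is `U(N)`-valued (`isUnitaryCfg_of_sheetEqs`), `N`-periodic (`isPeriodicCfg_of_sheetEqs`), every unit plaquette variable lies in
  `{1, w, w⁻¹}` hence within `‖w − 1‖` of `1` (`norm_hol_sub_one_le_of_sheetEqs`), so it is a member of `sfClass d L N ε₁ 0` once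
  `‖w − 1‖ ≤ ε₁` (`mem_sfClass_of_sheetEqs`); in the plane `(μ₀, ν₀)` the plaquette is `w⁻¹` at base points with `N ∣ x_{μ₀}`
  (`hol_of_sheetEqs_of_dvd`, `N ≥ 2`) and `1` at base points with `N ∣ x_{μ₀} − 1` (`hol_of_sheetEqs_of_dvd_sub_one`, `N ≥ 3`) — two ADJACENT
  coarse plaquettes with norm deviations `‖w − 1‖` and `0`.
* §3 `norm_Ad_eq_of_unitary` (conjugation by a unitary is an operator-norm isometry), `norm_plaqDev_step`, ★ `norm_plaqDev_chain` — under the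
  covariant forward-difference letter `‖(∇_U U(∂·))(·, κ; π)‖ ≤ γ` of a `U(N)`-valued `U` ([Balaban1985Variational] (10)-type currency, the
  letter of supKey) the norm deviation `‖U(∂p_x) − 1‖` is `γ`-Lipschitz along the direction `κ`:
  `‖U(∂p_x) − 1‖ ≤ ‖U(∂p_{x + m e_κ}) − 1‖ + mγ`; and `covGrad_fhol_le_of_smallField` — class membership ALONE (`SmallField U a`) bounds the
  covariant plaquette differences by `2a` (no minimality, no averaging; the kinematic ceiling used in 22b §5).

HONEST FRAMING.  Hypothesis-free kinematics of explicit configurations; nothing of Bałaban asserted or refuted; the sup key NOT touched here;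
no stub of K3⁸ v6 named or closed; N16 ∕ N07 NOT discharged; counts of record unmoved (typed 28∕28 · discharged 5∕28); one finite four-torus
at fixed `ε` — NOT ℝ⁴, NOT infinite volume, NOT OS, NOT a mass gap; the YM mass gap (Clay) is NOT proved by any of this — R4 closes the
conditional finite-𝕋⁴ rung `BalabanLadder.UV` only.

Sources: [Balaban1985Averaging] (9), (42)–(44) pp. 18–24; [Balaban1985Variational] (2), (6), (10) pp. 278–279.
-/

set_option autoImplicit false

open scoped BigOperators Matrix Matrix.Norms.L2Operator
open NormedSpace

namespace Summit.QuantumFields.YangMills.BalabanUVNodes.N16SheetDatum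

open Literature.MathematicalPhysics.QuantumFieldTheory.Balaban1983to89
open B7Prop1Explicit B7Prop2Explicit MatrixLog UnitaryModel
open T4AveragingDeficitWall hiding Site Plane Plaq Bond
open T4AveragingDeficitWallBoundary (IsPeriodicCfg)
open B7Prop1Local (hol_plaqWord_eq)
open Summit.QuantumFields.BalabanUV.T4Continuum
open AveragingDeficitTransport (mem_U1_of_unitary)
open MinimalActionRate (sfClass)

noncomputable section

variable {d : ℕ} {n : Type} [Fintype n] [DecidableEq n]

/-! ## §1 A central unitary unit at a prescribed distance from `1` -/

/-- **A CENTRAL UNITARY UNIT AT OPERATOR-NORM DISTANCE EXACTLY `ε` FROM `1`** (`0 ≤ ε ≤ 2`): `w = ζ(ε)·1` with the explicit point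
`ζ(ε) = (1 − ε²∕2) + iε√(1 − ε²∕4)` of the unit circle (`|ζ| = 1`, `|ζ − 1| = ε`; no trigonometry), `‖ζ·1 − 1‖ = |ζ − 1|·‖1‖`. [folklore] -/
theorem exists_central_unitary_norm_sub_one_eq [Nonempty n] {ε : ℝ} (h0 : 0 ≤ ε) (h2 : ε ≤ 2) :
    ∃ w : (Matrix n n ℂ)ˣ, w ∈ unitaryUnits (Matrix n n ℂ) ∧ ‖(w : Matrix n n ℂ) - 1‖ = ε := by
  set ζ : ℂ := ⟨1 - ε ^ 2 / 2, ε * Real.sqrt (1 - ε ^ 2 / 4)⟩ with hζdef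
  have hs : Real.sqrt (1 - ε ^ 2 / 4) ^ 2 = 1 - ε ^ 2 / 4 := Real.sq_sqrt (by nlinarith)
  have hζ1 : ‖ζ‖ = 1 := by
    have h : ‖ζ‖ ^ 2 = 1 := by
      rw [Complex.sq_norm, Complex.normSq_apply, hζdef]
      dsimp only
      nlinarith [hs]
    nlinarith [h, norm_nonneg ζ]
  have hζs : ‖ζ - 1‖ = ε := by
    have h : ‖ζ - 1‖ ^ 2 = ε ^ 2 := by
      rw [Complex.sq_norm, Complex.normSq_apply, hζdef]
      simp only [Complex.sub_re, Complex.one_re, Complex.sub_im, Complex.one_im, sub_zero]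
      nlinarith [hs]
    nlinarith [h, norm_nonneg (ζ - 1), h0]
  have hζ0 : ζ ≠ 0 := by intro h; rw [h, norm_zero] at hζ1; exact zero_ne_one hζ1
  have hc : (starRingEnd ℂ) ζ * ζ = 1 := by
    rw [Complex.conj_mul', ← Complex.ofReal_one, hζ1]; norm_num
  have hc' : ζ * (starRingEnd ℂ) ζ = 1 := by rw [mul_comm]; exact hc
  refine ⟨⟨ζ • (1 : Matrix n n ℂ), ζ⁻¹ • (1 : Matrix n n ℂ),
      by rw [smul_mul_smul_comm, mul_one, mul_inv_cancel₀ hζ0, one_smul],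
      by rw [smul_mul_smul_comm, mul_one, inv_mul_cancel₀ hζ0, one_smul]⟩, ?_, ?_⟩
  · rw [mem_unitaryUnits, Unitary.mem_iff]
    show star (ζ • (1 : Matrix n n ℂ)) * (ζ • 1) = 1 ∧ (ζ • (1 : Matrix n n ℂ)) * star (ζ • (1 : Matrix n n ℂ)) = 1
    constructor
    · rw [star_smul, star_one, smul_mul_smul_comm, mul_one, Complex.star_def, hc, one_smul]
    · rw [star_smul, star_one, smul_mul_smul_comm, mul_one, Complex.star_def, hc', one_smul]
  · show ‖ζ • (1 : Matrix n n ℂ) - 1‖ = ε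
    rw [show ζ • (1 : Matrix n n ℂ) - 1 = (ζ - 1) • (1 : Matrix n n ℂ) by rw [sub_smul, one_smul], norm_smul, norm_one,
      mul_one, hζs]

/-! ## §2 The sheet datum, through its two defining equations -/

section Sheet

/-! A configuration `V` obeys THE SHEET EQUATIONS for `(N, μ₀, ν₀, w)` when `V(x, κ) = 1` for `κ ≠ ν₀` and
`V(x, ν₀) = w` if `N ∣ x_{μ₀}`, `= 1` otherwise — one charged sheet of `ν₀`-bonds per period.  Every statement below takes the two equations
as hypotheses `h1`, `h2`; `exists_sheetEqs` supplies the (unique) solution. -/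

variable {N : ℕ} {μ₀ ν₀ : Fin d} {w : (Matrix n n ℂ)ˣ} {V : Site d → Fin d → (Matrix n n ℂ)ˣ}

/-- **THE SHEET EQUATIONS HAVE A SOLUTION** (the WITNESS `V(x, κ) = w` if `κ = ν₀ ∧ N ∣ x_{μ₀}`, else `1`). [folklore] -/
theorem exists_sheetEqs (N : ℕ) (μ₀ ν₀ : Fin d) (w : (Matrix n n ℂ)ˣ) :
    ∃ V : Site d → Fin d → (Matrix n n ℂ)ˣ,
      (∀ (x : Site d) (κ : Fin d), κ ≠ ν₀ → V x κ = 1) ∧ (∀ x : Site d, V x ν₀ = if (N : ℤ) ∣ x μ₀ then w else 1) :=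
  ⟨fun x κ => if κ = ν₀ ∧ (N : ℤ) ∣ x μ₀ then w else 1, fun x κ hκ => by simp [hκ], fun x => by simp⟩

/-- A solution of the sheet equations is `U(N)`-valued when `w` is. [folklore] -/
theorem isUnitaryCfg_of_sheetEqs (h1 : ∀ (x : Site d) (κ : Fin d), κ ≠ ν₀ → V x κ = 1)
    (h2 : ∀ x : Site d, V x ν₀ = if (N : ℤ) ∣ x μ₀ then w else 1) (hw : w ∈ unitaryUnits (Matrix n n ℂ)) :
    IsUnitaryCfg V := by
  intro x κ
  by_cases hκ : κ = ν₀
  · subst hκ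
    rw [h2 x]
    split_ifs
    · exact hw
    · exact (unitaryUnits _).one_mem
  · rw [h1 x κ hκ]; exact (unitaryUnits _).one_mem

/-- A solution of the sheet equations is `N`-periodic. [folklore] -/
theorem isPeriodicCfg_of_sheetEqs (h1 : ∀ (x : Site d) (κ : Fin d), κ ≠ ν₀ → V x κ = 1)
    (h2 : ∀ x : Site d, V x ν₀ = if (N : ℤ) ∣ x μ₀ then w else 1) : IsPeriodicCfg V (N : ℤ) := by
  intro x κ μ
  by_cases hμ : μ = ν₀
  · subst hμ
    rw [h2, h2]
    have h : ((N : ℤ) ∣ (x + (N : ℤ) • e κ) μ₀) ↔ ((N : ℤ) ∣ x μ₀) := by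
      rw [Pi.add_apply, Pi.smul_apply, e_apply, smul_eq_mul]
      split_ifs
      · rw [mul_one]; exact (dvd_add_left (dvd_refl _))
      · rw [mul_zero, add_zero]
    simp only [h]
  · rw [h1 _ μ hμ, h1 _ μ hμ]

/-- Unitary telescoping for the plaquettes of the sheet: for `a, b ∈ {1, w}` with `w ∈ U1`, `‖a·b⁻¹ − 1‖ ≤ ‖w − 1‖`. [folklore] -/
theorem norm_ite_mul_ite_inv_sub_one_le [Nonempty n] (hw : w ∈ U1 (Matrix n n ℂ)) (P Q : Prop) [Decidable P] [Decidable Q] :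
    ‖(((if P then w else 1) * (if Q then w else 1)⁻¹ : (Matrix n n ℂ)ˣ) : Matrix n n ℂ) - 1‖
      ≤ ‖(w : Matrix n n ℂ) - 1‖ := by
  by_cases hP : P <;> by_cases hQ : Q <;> simp only [hP, hQ, if_true, if_false, mul_inv_cancel, inv_one, mul_one,
    one_mul, Units.val_one, sub_self, norm_zero, norm_nonneg, le_refl]
  exact norm_inv_sub_one_le hw

/-- **EVERY UNIT PLAQUETTE VARIABLE OF A SOLUTION OF THE SHEET EQUATIONS IS WITHIN `‖w − 1‖` OF `1`** (it is `1`, `w` or `w⁻¹`: a plaquette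
contains `ν₀`-bonds only if `ν₀` spans it, and then exactly two of them). [folklore] -/
theorem norm_hol_sub_one_le_of_sheetEqs [Nonempty n] (h1 : ∀ (x : Site d) (κ : Fin d), κ ≠ ν₀ → V x κ = 1)
    (h2 : ∀ x : Site d, V x ν₀ = if (N : ℤ) ∣ x μ₀ then w else 1) (hw : w ∈ unitaryUnits (Matrix n n ℂ)) (x : Site d)
    {i i' : Fin d} (hii' : i ≠ i') :
    ‖((hol V x (plaqWord i i') : (Matrix n n ℂ)ˣ) : Matrix n n ℂ) - 1‖ ≤ ‖(w : Matrix n n ℂ) - 1‖ := by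
  have hw1 : w ∈ U1 (Matrix n n ℂ) := mem_U1_of_unitary hw
  rw [hol_plaqWord_eq]
  by_cases hi' : i' = ν₀
  · subst hi'
    rw [h1 _ _ hii', h1 _ _ hii', h2, h2, one_mul, inv_one, mul_one]
    exact norm_ite_mul_ite_inv_sub_one_le hw1 _ _
  · by_cases hi : i = ν₀
    · subst hi
      rw [h1 _ _ hi', h1 _ _ hi', h2, h2, mul_one, inv_one, mul_one]
      exact norm_ite_mul_ite_inv_sub_one_le hw1 _ _
    · rw [h1 _ _ hi, h1 _ _ hi', h1 _ _ hi, h1 _ _ hi']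
      simp

/-- Hence **A SOLUTION OF THE SHEET EQUATIONS LIES IN THE LEVEL-`0` CLASS `sfClass d L N ε₁ 0`** as soon as `w` is unitary with `‖w − 1‖ ≤ ε₁`.
[cite: Balaban1985Variational, (2) p.278, (6) p.278] -/
theorem mem_sfClass_of_sheetEqs [Nonempty n] (L : ℕ) (h1 : ∀ (x : Site d) (κ : Fin d), κ ≠ ν₀ → V x κ = 1)
    (h2 : ∀ x : Site d, V x ν₀ = if (N : ℤ) ∣ x μ₀ then w else 1) (hw : w ∈ unitaryUnits (Matrix n n ℂ)) {ε₁ : ℝ}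
    (hε : ‖(w : Matrix n n ℂ) - 1‖ ≤ ε₁) : V ∈ sfClass d L N ε₁ 0 := by
  refine ⟨isUnitaryCfg_of_sheetEqs h1 h2 hw, ?_, fun x κ κ' hκκ' => ?_⟩
  · have : ((N * L ^ 0 : ℕ) : ℤ) = (N : ℤ) := by simp
    rw [this]; exact isPeriodicCfg_of_sheetEqs h1 h2
  · have h := norm_hol_sub_one_le_of_sheetEqs h1 h2 hw x hκκ'
    simpa using h.trans hε

/-- No integer and its successor are both multiples of `N ≥ 2`. [folklore] -/
theorem no_consecutive_multiples (hN : 2 ≤ N) {t : ℤ} (ht : (N : ℤ) ∣ t) : ¬ (N : ℤ) ∣ t + 1 := by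
  intro h
  have h1 : (N : ℤ) ∣ 1 := by simpa using dvd_sub h ht
  have := Int.le_of_dvd one_pos h1
  omega

/-- **THE CHARGED PLAQUETTE**: in the plane `(μ₀, ν₀)`, at a base point with `N ∣ x_{μ₀}` (`N ≥ 2`, `μ₀ ≠ ν₀`), the plaquette variable of a
solution of the sheet equations is `w⁻¹`. [folklore] -/
theorem hol_of_sheetEqs_of_dvd (h1 : ∀ (x : Site d) (κ : Fin d), κ ≠ ν₀ → V x κ = 1)
    (h2 : ∀ x : Site d, V x ν₀ = if (N : ℤ) ∣ x μ₀ then w else 1) (hN : 2 ≤ N) (hμν : μ₀ ≠ ν₀) {x : Site d}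
    (hx : (N : ℤ) ∣ x μ₀) : hol V x (plaqWord μ₀ ν₀) = w⁻¹ := by
  rw [hol_plaqWord_eq, h1 _ _ hμν, h1 _ _ hμν, h2, h2]
  have h3 : ¬ (N : ℤ) ∣ (x + e μ₀) μ₀ := by
    rw [Pi.add_apply, e_apply, if_pos rfl]; exact no_consecutive_multiples hN hx
  rw [if_neg h3, if_pos hx]; simp

/-- **THE NEUTRAL NEIGHBOUR**: one lattice step on in direction `μ₀` (`N ∣ x_{μ₀} − 1`, `N ≥ 3`) the plaquette variable of the same plane is
`1`. [folklore] -/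
theorem hol_of_sheetEqs_of_dvd_sub_one (h1 : ∀ (x : Site d) (κ : Fin d), κ ≠ ν₀ → V x κ = 1)
    (h2 : ∀ x : Site d, V x ν₀ = if (N : ℤ) ∣ x μ₀ then w else 1) (hN : 3 ≤ N) (hμν : μ₀ ≠ ν₀) {x : Site d}
    (hx : (N : ℤ) ∣ x μ₀ - 1) : hol V x (plaqWord μ₀ ν₀) = 1 := by
  rw [hol_plaqWord_eq, h1 _ _ hμν, h1 _ _ hμν, h2, h2]
  have h0 : ¬ (N : ℤ) ∣ x μ₀ := by
    intro h
    have h4 : (N : ℤ) ∣ 1 := by simpa using dvd_sub h hx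
    have := Int.le_of_dvd one_pos h4
    omega
  have h3 : ¬ (N : ℤ) ∣ (x + e μ₀) μ₀ := by
    rw [Pi.add_apply, e_apply, if_pos rfl]
    intro h
    have h4 : (N : ℤ) ∣ 2 := by
      have := dvd_sub h hx; simpa [show x μ₀ + 1 - (x μ₀ - 1) = (2 : ℤ) by ring] using this
    have := Int.le_of_dvd two_pos h4
    omega
  rw [if_neg h3, if_neg h0]; simp

end Sheet

/-! ## §3 The covariant chain: the norm deviation of a plaquette variable is `γ`-Lipschitz along every lattice direction -/

/-- Conjugation by a unitary unit is an isometry of `M_n(ℂ)` in the operator norm: `‖Ad_u X‖ = ‖X‖`. [folklore] -/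
theorem norm_Ad_eq_of_unitary [Nonempty n] {u : (Matrix n n ℂ)ˣ} (hu : u ∈ unitaryUnits (Matrix n n ℂ)) (X : Matrix n n ℂ) :
    ‖Ad u X‖ = ‖X‖ := by
  have h1 := mem_U1_of_unitary hu
  refine le_antisymm ?_ ?_
  · unfold Ad
    calc _ ≤ ‖(u : Matrix n n ℂ) * X‖ * ‖((u⁻¹ : (Matrix n n ℂ)ˣ) : Matrix n n ℂ)‖ := norm_mul_le _ _
      _ ≤ (‖(u : Matrix n n ℂ)‖ * ‖X‖) * 1 := by gcongr; exacts [norm_mul_le _ _, h1.2]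
      _ ≤ (1 * ‖X‖) * 1 := by gcongr; exact h1.1
      _ = ‖X‖ := by ring
  · have h2 := mem_U1_of_unitary ((unitaryUnits _).inv_mem hu)
    have he : X = ((u⁻¹ : (Matrix n n ℂ)ˣ) : Matrix n n ℂ) * Ad u X * (u : Matrix n n ℂ) := by
      unfold Ad
      simp only [← mul_assoc, Units.inv_mul, one_mul]
      rw [mul_assoc, Units.inv_mul, mul_one]
    calc ‖X‖ = ‖((u⁻¹ : (Matrix n n ℂ)ˣ) : Matrix n n ℂ) * Ad u X * (u : Matrix n n ℂ)‖ := by rw [← he]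
      _ ≤ ‖((u⁻¹ : (Matrix n n ℂ)ˣ) : Matrix n n ℂ) * Ad u X‖ * ‖(u : Matrix n n ℂ)‖ := norm_mul_le _ _
      _ ≤ (‖((u⁻¹ : (Matrix n n ℂ)ˣ) : Matrix n n ℂ)‖ * ‖Ad u X‖) * 1 := by gcongr; exacts [norm_mul_le _ _, h1.1]
      _ ≤ (1 * ‖Ad u X‖) * 1 := by gcongr; exact h2.1
      _ = ‖Ad u X‖ := by ring

/-- ONE COVARIANT STEP: under `‖(∇_U U(∂·))(x, κ; π)‖ ≤ γ` the norm deviations of the two plaquette variables differ by at most `γ`: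
`‖U(∂p_x) − 1‖ ≤ ‖U(∂p_{x+e_κ}) − 1‖ + γ` and `‖U(∂p_{x+e_κ}) − 1‖ ≤ ‖U(∂p_x) − 1‖ + γ` (`Ad` by the unitary bond variable preserves
`‖· − 1‖`). [folklore] -/
theorem norm_plaqDev_step [Nonempty n] {U : Site d → Fin d → (Matrix n n ℂ)ˣ} (hU : IsUnitaryCfg U) {γ : ℝ}
    (π : T4AveragingDeficitWall.Plane d) (x : Site d) (κ : Fin d)
    (hγ : ‖covGrad U (fun q => ((fhol U q : (Matrix n n ℂ)ˣ) : Matrix n n ℂ)) x κ π‖ ≤ γ) :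
    ‖((fhol U (x, π) : (Matrix n n ℂ)ˣ) : Matrix n n ℂ) - 1‖
        ≤ ‖((fhol U (x + e κ, π) : (Matrix n n ℂ)ˣ) : Matrix n n ℂ) - 1‖ + γ ∧
      ‖((fhol U (x + e κ, π) : (Matrix n n ℂ)ˣ) : Matrix n n ℂ) - 1‖
        ≤ ‖((fhol U (x, π) : (Matrix n n ℂ)ˣ) : Matrix n n ℂ) - 1‖ + γ := by
  set Q : Matrix n n ℂ := ((fhol U (x, π) : (Matrix n n ℂ)ˣ) : Matrix n n ℂ)
  set Q' : Matrix n n ℂ := ((fhol U (x + e κ, π) : (Matrix n n ℂ)ˣ) : Matrix n n ℂ)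
  have hA : ‖Ad (U x κ) Q' - 1‖ = ‖Q' - 1‖ := by
    have : Ad (U x κ) Q' - 1 = Ad (U x κ) (Q' - 1) := by unfold Ad; rw [mul_sub, sub_mul, mul_one, Units.mul_inv]
    rw [this, norm_Ad_eq_of_unitary (hU x κ)]
  have hγ' : ‖Ad (U x κ) Q' - Q‖ ≤ γ := hγ
  constructor
  · calc ‖Q - 1‖ = ‖(Ad (U x κ) Q' - 1) - (Ad (U x κ) Q' - Q)‖ := by congr 1; abel
      _ ≤ ‖Ad (U x κ) Q' - 1‖ + ‖Ad (U x κ) Q' - Q‖ := norm_sub_le _ _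
      _ ≤ ‖Q' - 1‖ + γ := by rw [hA]; gcongr
  · calc ‖Q' - 1‖ = ‖Ad (U x κ) Q' - 1‖ := hA.symm
      _ = ‖(Ad (U x κ) Q' - Q) + (Q - 1)‖ := by congr 1; abel
      _ ≤ ‖Ad (U x κ) Q' - Q‖ + ‖Q - 1‖ := norm_add_le _ _
      _ ≤ ‖Q - 1‖ + γ := by linarith

/-- ★ **THE COVARIANT CHAIN**: under the letter `‖(∇_U U(∂·))(·, κ; π)‖ ≤ γ`, `‖U(∂p_x) − 1‖ ≤ ‖U(∂p_{x + m e_κ}) − 1‖ + m·γ` for every `m : ℕ` —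
the norm deviation of the plaquette variable is `γ`-Lipschitz along the lattice direction `κ`. [folklore] -/
theorem norm_plaqDev_chain [Nonempty n] {U : Site d → Fin d → (Matrix n n ℂ)ˣ} (hU : IsUnitaryCfg U) {γ : ℝ}
    (π : T4AveragingDeficitWall.Plane d) (κ : Fin d)
    (hγ : ∀ x : Site d, ‖covGrad U (fun q => ((fhol U q : (Matrix n n ℂ)ˣ) : Matrix n n ℂ)) x κ π‖ ≤ γ) :
    ∀ (m : ℕ) (x : Site d), ‖((fhol U (x, π) : (Matrix n n ℂ)ˣ) : Matrix n n ℂ) - 1‖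
      ≤ ‖((fhol U (x + (m : ℤ) • e κ, π) : (Matrix n n ℂ)ˣ) : Matrix n n ℂ) - 1‖ + m * γ
  | 0, x => by simp
  | m + 1, x => by
    have h1 := (norm_plaqDev_step hU π x κ (hγ x)).1
    have h2 := norm_plaqDev_chain hU π κ hγ m (x + e κ)
    have he : x + e κ + (m : ℤ) • e κ = x + ((m : ℤ) + 1) • e κ := by
      rw [add_smul, one_smul]; abel
    rw [he] at h2
    push_cast
    linarith [h1, h2]

/-- **CLASS MEMBERSHIP ALONE BOUNDS THE COVARIANT PLAQUETTE DIFFERENCES BY TWICE THE PLAQUETTE RADIUS**: for a `U(N)`-valued `U` with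
`SmallField U a`, `‖(∇_U U(∂·))(x, κ; π)‖ ≤ 2a` (`Ad` by the unitary bond variable is an isometry; triangle inequality through `1`).  No minimality,
no averaging. [folklore] -/
theorem covGrad_fhol_le_of_smallField [Nonempty n] {U : Site d → Fin d → (Matrix n n ℂ)ˣ} (hUu : IsUnitaryCfg U) {a : ℝ}
    (hUs : SmallField U a) (x : Site d) (κ : Fin d) (π : T4AveragingDeficitWall.Plane d) :
    ‖covGrad U (fun q => ((fhol U q : (Matrix n n ℂ)ˣ) : Matrix n n ℂ)) x κ π‖ ≤ 2 * a := by
  obtain ⟨⟨μ, ν⟩, hμν⟩ := π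
  have h1 : ‖((fhol U (x, ⟨(μ, ν), hμν⟩) : (Matrix n n ℂ)ˣ) : Matrix n n ℂ) - 1‖ ≤ a := hUs x μ ν (ne_of_lt hμν)
  have h2 : ‖((fhol U (x + e κ, ⟨(μ, ν), hμν⟩) : (Matrix n n ℂ)ˣ) : Matrix n n ℂ) - 1‖ ≤ a := hUs (x + e κ) μ ν (ne_of_lt hμν)
  set Q : Matrix n n ℂ := ((fhol U (x, ⟨(μ, ν), hμν⟩) : (Matrix n n ℂ)ˣ) : Matrix n n ℂ)
  set Q' : Matrix n n ℂ := ((fhol U (x + e κ, ⟨(μ, ν), hμν⟩) : (Matrix n n ℂ)ˣ) : Matrix n n ℂ)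
  have hA : ‖Ad (U x κ) Q' - 1‖ = ‖Q' - 1‖ := by
    have : Ad (U x κ) Q' - 1 = Ad (U x κ) (Q' - 1) := by unfold Ad; rw [mul_sub, sub_mul, mul_one, Units.mul_inv]
    rw [this, norm_Ad_eq_of_unitary (hUu x κ)]
  show ‖Ad (U x κ) Q' - Q‖ ≤ 2 * a
  calc ‖Ad (U x κ) Q' - Q‖ = ‖(Ad (U x κ) Q' - 1) - (Q - 1)‖ := by congr 1; abel
    _ ≤ ‖Ad (U x κ) Q' - 1‖ + ‖Q - 1‖ := norm_sub_le _ _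
    _ ≤ a + a := by rw [hA]; exact add_le_add h2 h1
    _ = 2 * a := by ring

end

end Summit.QuantumFields.YangMills.BalabanUVNodes.N16SheetDatum
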